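import Literature.NumberTheory.PAdicHodge.AinfRamifiedTopology
import HarnessLib

/-!
# `A_inf(𝒪) = 𝔸_inf(F)[ϖ]` is `ω`-ADICALLY complete and separated (`ω = ϖ − [ϖ♭]`, `ker θ_𝒪 = (ω)`): `ωⁿA_inf(𝒪)` is
# `p`-adically closed (proofs only)

Topic `Literature/NumberTheory/PAdicHodge`; namespace `Literature.NumberTheory.PAdicHodge.AinfRam`. THEOREMS ONLY (no definition,
no named fact, no instance, no `sorry`). Sequel of `AinfRamifiedKernel` (`ker θ_𝒪 = (ω)`, `θ_𝒪` onto `𝒪_{ℂ_F}`), `AinfRamifiedComplete`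
(`A_inf(𝒪)` is a domain; `(p, ξ)`-adic completeness) and `AinfRamifiedTopology` (`𝔦 = (p, ω)`-adic completeness). The ramified
twin of the unramified `isAdicComplete_span_xi` (`𝔸_inf` is `ξ`-adically complete), needed to compare the `(p, ω)`-adic evaluation
of formal-group series at points of `ker θ_𝒪` with their `ξ`-adic evaluation in `B_dR⁺` (additivity of the ω- and η-periods over the
ramified base; BSD route EdixhovenFibreFiveSeven, crux K★ `stmt-BirchSwinnertonDyer-22226`, road (R1)).

* §1 `prime_omega` — `ω` is prime (`A_inf(𝒪)/ω ≅ 𝒪_{ℂ_F}` is a domain); `not_omega_dvd_natCast_pow` (`θ_𝒪(p^a) = p^a ≠ 0`);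
  `integerC_eq_zero_of_forall_pow_dvd` (`𝒪_{ℂ_F}` is `p`-adically separated).
* §2 **`omega_pow_dvd_of_forall`** — if `x ∈ ωⁿA + p^aA` for every `a`, then `ωⁿ ∣ x` (induction on `n`: `ω` prime and
  `ω ∤ p`, cancellation of `ω`, and `⋂ₐ p^a 𝒪_{ℂ_F} = 0` read through `θ_𝒪`), i.e. `ωⁿA_inf(𝒪)` is `p`-adically (and
  `𝔦`-adically) closed.
* §3 **`isAdicComplete_span_omega`** — `A_inf(𝒪)` is `ω`-adically complete and separated (a `ω`-adic Cauchy sequence is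
  `𝔦`-adic Cauchy; its `𝔦`-adic limit is an `ω`-adic limit by §2).

## References
* [FarguesFontaine2018] L. Fargues, J.-M. Fontaine, Astérisque 406 (2018), §1.4, §2.2 (primitive elements of degree one).
* [FontaineAsterisque223III] J.-M. Fontaine, Astérisque 223 (1994), Exp. II §1.3 (topologies on `A_inf`).
-/

noncomputable section

open Ideal Field ValuativeRel WittVector

namespace Literature.NumberTheory.PAdicHodge

open Literature.NumberTheory.GaloisRepresentations
open Literature.NumberTheory.GaloisRepresentations.IsNonarchimedeanLocalField

namespace AinfRam

variable {F : Type} [Field F] [ValuativeRel F] [TopologicalSpace F] [IsNonarchimedeanLocalField F] [CharZero F]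
  {p : ℕ} [Fact p.Prime] [Fact (¬ IsUnit (p : integerC F))] [IsAdicComplete (Ideal.span {(p : integerC F)}) (integerC F)]
  {hp : valuation F p < 1} (D : EisensteinRoot F p hp) (hF : Function.Surjective (fontaineTheta (integerC F) p))

/-! ## §1 `ω` is prime; `ω ∤ pᵃ`; `𝒪_{ℂ_F}` is `p`-adically separated -/

include hF in
/-- **`ω` is a prime element of `A_inf(𝒪)`**: `(ω) = ker θ_𝒪` with `θ_𝒪` onto the domain `𝒪_{ℂ_F}`.
[cite: FarguesFontaine2018, §2.2 (Cor. 2.2.8)] -/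
theorem prime_omega : Prime (omega D) := by
  haveI := isDomain D hF
  rw [← Ideal.span_singleton_prime (omega_ne_zero D hF), ← ker_theta_eq_span_omega]
  exact RingHom.ker_isPrime _

/-- `θ_𝒪(p^a) = p^a ≠ 0` in `𝒪_{ℂ_F}`, so **`ω ∤ p^a`**. [cite: FarguesFontaine2018, §2.2] -/
theorem not_omega_dvd_natCast_pow (a : ℕ) : ¬ omega D ∣ (p : AinfRam D) ^ a := by
  intro h
  have hmem : (p : AinfRam D) ^ a ∈ RingHom.ker (theta D) := by
    rw [ker_theta_eq_span_omega]; exact Ideal.mem_span_singleton.2 h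
  rw [RingHom.mem_ker, map_pow, map_natCast] at hmem
  have h' := congrArg (fun z : integerC F => (z : CompletedAlgClosure F)) hmem
  simp only [SubmonoidClass.coe_pow, Subring.coe_natCast, ZeroMemClass.coe_zero] at h'
  exact pow_ne_zero a (natCast_C_ne_zero (F := F) (Fact.out : p.Prime).ne_zero) h'

omit [CharZero F] [Fact p.Prime] [Fact (¬ IsUnit (p : integerC F))] [IsAdicComplete (Ideal.span {(p : integerC F)}) (integerC F)] in
/-- **`𝒪_{ℂ_F}` is `p`-adically separated**: `p^a ∣ y` for all `a` forces `y = 0` (`‖y‖ ≤ ‖p‖^a → 0`).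
[cite: FontaineAsterisque223III, Exp. II §1.3] -/
theorem integerC_eq_zero_of_forall_pow_dvd (hp : valuation F p < 1) {y : integerC F}
    (h : ∀ a : ℕ, (p : integerC F) ^ a ∣ y) : y = 0 := by
  have hp1 : ‖(p : CompletedAlgClosure F)‖ < 1 := norm_natCast_C_lt_one hp
  have hle : ∀ a : ℕ, ‖((y : integerC F) : CompletedAlgClosure F)‖ ≤ ‖(p : CompletedAlgClosure F)‖ ^ a := fun a => by
    obtain ⟨z, hz⟩ := h a
    have h' := congrArg (fun w : integerC F => (w : CompletedAlgClosure F)) hz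
    simp only [Subring.coe_mul, SubmonoidClass.coe_pow, Subring.coe_natCast] at h'
    rw [h', norm_mul, norm_pow]
    exact mul_le_of_le_one_right (by positivity) (norm_coe_integerC_le _)
  have h0 : ‖((y : integerC F) : CompletedAlgClosure F)‖ ≤ 0 :=
    ge_of_tendsto (tendsto_pow_atTop_nhds_zero_of_lt_one (norm_nonneg _) hp1) (Filter.Eventually.of_forall hle)
  exact Subtype.ext (norm_le_zero_iff.1 h0)

/-! ## §2 `ωⁿ A_inf(𝒪)` is `p`-adically closed -/

include hF in
/-- `ωⁿ ∣ p^a · y ⟹ ωⁿ ∣ y` (`ω` prime, `ω ∤ p`). [cite: FarguesFontaine2018, §2.2] -/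
theorem omega_pow_dvd_of_dvd_natCast_pow_mul {n a : ℕ} {y : AinfRam D} (h : omega D ^ n ∣ (p : AinfRam D) ^ a * y) :
    omega D ^ n ∣ y := by
  haveI := isDomain D hF
  exact (prime_omega D hF).pow_dvd_of_dvd_mul_left n (not_omega_dvd_natCast_pow D a) h

include hF in
/-- **`ωⁿA_inf(𝒪)` is `p`-adically closed**: if `x ∈ ωⁿA + p^aA` for every `a`, then `ωⁿ ∣ x`. Induction on `n`: with `x = ωⁿx'`,
the hypothesis at level `n + 1` gives `x' ∈ ωA + p^aA` for every `a` (cancel `ωⁿ` after `ωⁿ ∣ p^a z ⟹ ωⁿ ∣ z`), hence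
`θ_𝒪(x') ∈ ⋂ₐ p^a𝒪_{ℂ_F} = 0`, i.e. `x' ∈ ker θ_𝒪 = (ω)`. [cite: FarguesFontaine2018, §2.2] [cite: FontaineAsterisque223III, Exp. II §1.3] -/
theorem omega_pow_dvd_of_forall (n : ℕ) {x : AinfRam D}
    (h : ∀ a : ℕ, ∃ y z : AinfRam D, x = omega D ^ n * y + (p : AinfRam D) ^ a * z) : omega D ^ n ∣ x := by
  haveI := isDomain D hF
  induction n generalizing x with
  | zero => exact ⟨x, by rw [pow_zero, one_mul]⟩
  | succ n ih =>
    -- `ωⁿ ∣ x`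
    obtain ⟨x', rfl⟩ : omega D ^ n ∣ x := ih fun a => by
      obtain ⟨y, z, hyz⟩ := h a
      exact ⟨omega D * y, z, by rw [hyz, pow_succ]; ring⟩
    -- `x' ∈ ωA + p^aA` for every `a`
    have hx' : ∀ a : ℕ, ∃ y z : AinfRam D, x' = omega D * y + (p : AinfRam D) ^ a * z := fun a => by
      obtain ⟨y, z, hyz⟩ := h a
      have hz : omega D ^ n ∣ (p : AinfRam D) ^ a * z :=
        ⟨x' - omega D * y, by linear_combination (-1 : AinfRam D) * hyz⟩
      obtain ⟨z', rfl⟩ := omega_pow_dvd_of_dvd_natCast_pow_mul D hF hz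
      refine ⟨y, z', ?_⟩
      have hcancel : omega D ^ n * (x' - (omega D * y + (p : AinfRam D) ^ a * z')) = 0 := by linear_combination hyz
      exact sub_eq_zero.1 ((mul_eq_zero.1 hcancel).resolve_left (pow_ne_zero n (omega_ne_zero D hF)))
    -- `θ_𝒪(x') = 0`
    have hθ : theta D x' = 0 := by
      refine integerC_eq_zero_of_forall_pow_dvd hp fun a => ?_
      obtain ⟨y, z, hyz⟩ := hx' a
      refine ⟨theta D z, ?_⟩
      rw [hyz, map_add, map_mul, map_mul, theta_omega, zero_mul, zero_add, map_pow, map_natCast]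
    have hmem : x' ∈ Ideal.span {omega D} := by rw [← ker_theta_eq_span_omega]; exact hθ
    obtain ⟨w, hw⟩ := Ideal.mem_span_singleton'.1 hmem
    exact ⟨w, by rw [← hw, pow_succ]; ring⟩

include hF in
/-- **Membership form**: `x ∈ (ωⁿ) + (p^a)` for all `a` ⟹ `x ∈ (ωⁿ)`. [cite: FarguesFontaine2018, §2.2] -/
theorem mem_span_omega_pow_of_forall (n : ℕ) {x : AinfRam D}
    (h : ∀ a : ℕ, x ∈ Ideal.span {omega D ^ n} ⊔ Ideal.span {(p : AinfRam D) ^ a}) : x ∈ Ideal.span {omega D ^ n} := by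
  refine Ideal.mem_span_singleton.2 (omega_pow_dvd_of_forall D hF n fun a => ?_)
  obtain ⟨u, hu, v, hv, huv⟩ := Submodule.mem_sup.1 (h a)
  obtain ⟨y, rfl⟩ := Ideal.mem_span_singleton'.1 hu
  obtain ⟨z, rfl⟩ := Ideal.mem_span_singleton'.1 hv
  exact ⟨y, z, by rw [← huv]; ring⟩

/-! ## §3 `ω`-adic completeness -/

omit [IsAdicComplete (Ideal.span {(p : integerC F)}) (integerC F)] in
/-- `(p, ω)^{a+b} ⊆ (p^a) + (ω^b)`. [cite: FontaineAsterisque223III, Exp. II §1.3] -/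
theorem span_p_omega_pow_le (a b : ℕ) :
    Ideal.span {(p : AinfRam D), omega D} ^ (a + b) ≤ Ideal.span {(p : AinfRam D) ^ a} ⊔ Ideal.span {omega D ^ b} := by
  rw [Ideal.span_insert, ← Ideal.span_singleton_pow, ← Ideal.span_singleton_pow]
  exact Ideal.sup_pow_add_le_pow_sup_pow

include hF in
/-- **`A_inf(𝒪)` is `ω`-adically complete and separated.** Separatedness: `⋂ ωⁿA ⊆ ⋂ 𝔦ⁿ = 0`; completeness: an `ω`-adic Cauchy
sequence is `𝔦`-adic Cauchy (`𝔦 = (p, ω)`), and its `𝔦`-adic limit is an `ω`-adic limit because `ωⁿA` is `p`-adically closed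
(`mem_span_omega_pow_of_forall`). [cite: FarguesFontaine2018, §1.4 and §2.2] [cite: FontaineAsterisque223III, Exp. II §1.3] -/
theorem isAdicComplete_span_omega : IsAdicComplete (Ideal.span {omega D}) (AinfRam D) := by
  haveI hI : IsAdicComplete (Ideal.span {(p : AinfRam D), omega D}) (AinfRam D) := AinfRamTop.isAdicComplete_ideal D
  have hle : Ideal.span {omega D} ≤ Ideal.span {(p : AinfRam D), omega D} := Ideal.span_mono (by simp)
  haveI : IsHausdorff (Ideal.span {omega D}) (AinfRam D) := by
    refine ⟨fun x hx => ?_⟩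
    refine IsHausdorff.haus (IsAdicComplete.toIsHausdorff (I := Ideal.span {(p : AinfRam D), omega D})) x fun n => ?_
    have h := hx n
    rw [smul_eq_mul, Ideal.mul_top, SModEq.zero] at h ⊢
    exact Ideal.pow_right_mono hle n h
  haveI : IsPrecomplete (Ideal.span {omega D}) (AinfRam D) := by
    refine ⟨fun f hf => ?_⟩
    have hf' : ∀ {m n : ℕ}, m ≤ n → f m ≡ f n [SMOD (Ideal.span {(p : AinfRam D), omega D} ^ m • ⊤ :
        Submodule (AinfRam D) (AinfRam D))] := by
      intro m n hmn
      have h := hf hmn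
      rw [smul_eq_mul, Ideal.mul_top, SModEq.sub_mem] at h ⊢
      exact Ideal.pow_right_mono hle m h
    obtain ⟨L, hL⟩ := IsPrecomplete.prec (IsAdicComplete.toIsPrecomplete (I := Ideal.span {(p : AinfRam D), omega D})) hf'
    refine ⟨L, fun n => ?_⟩
    rw [smul_eq_mul, Ideal.mul_top, SModEq.sub_mem, Ideal.span_singleton_pow]
    refine mem_span_omega_pow_of_forall D hF n fun a => ?_
    have h1 : f n - f (a + n) ∈ Ideal.span {omega D ^ n} := by
      have h := hf (Nat.le_add_left n a)
      rwa [smul_eq_mul, Ideal.mul_top, SModEq.sub_mem, Ideal.span_singleton_pow] at h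
    have h2 : f (a + n) - L ∈ Ideal.span {(p : AinfRam D) ^ a} ⊔ Ideal.span {omega D ^ n} := by
      have h := hL (a + n)
      rw [smul_eq_mul, Ideal.mul_top, SModEq.sub_mem] at h
      exact span_p_omega_pow_le D a n h
    have h3 : f n - L = (f n - f (a + n)) + (f (a + n) - L) := by ring
    rw [h3, sup_comm]
    exact Submodule.add_mem _ (Submodule.mem_sup_right h1) h2
  exact ⟨⟩

end AinfRam

end Literature.NumberTheory.PAdicHodge

end
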